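import Summits.BirchSwinnertonDyer.BirchSwinnertonDyer.Theorems.BiquadraticEisensteinDescentHeegnerTwistCouplingInSupplyFrobeniusFanCorner
import Summits.BirchSwinnertonDyer.BirchSwinnertonDyer.Theorems.BiquadraticEisensteinDescentHeegnerTwistCouplingInSupplySylvesterCornerCruxOnFamily
import HarnessLib

set_option linter.dupNamespace false -- `Summit.BirchSwinnertonDyer.BirchSwinnertonDyer.Theorems.…` (summit = sub, D-0017)
set_option autoImplicit false

/-!
# Crux `HeegnerTwistCouplingInSupply` (stmt-BirchSwinnertonDyer-21381) — the Frobenius-fan corner, II: the INFINITE-FAMILY reading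
# (digit set ↦ corner set), the crux BODY for `W = W_n` at every digit-non-zero prime `n ≡ 8 (mod 9)`, and the instance `p = 53`
# (card `chebotarev-digit-supply`, cruxidea seat 1 g38)

Route `BiquadraticEisensteinDescent` (cell `pub/bsd-wall`, width seat `bsd-wall-cm-bed-w4` g30; `--supports` 21381, helper). THEOREMS ONLY
(no `def`, no named fact, no `sorry`). BSD is not proved by any of this; the crux (residual C⁺) and its registered stubs are untouched.
Sequel of `…FrobeniusFanCorner` (`cruxOnSylvesterCorner_of_digit`: the corner at every prime `p ≡ 8 (mod 9)` with non-zero slice digit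
`3 ∤ num Σ_{t ≡ 3 (27)} H(4p − t²)`, modulo `hDescU`, `hCube`, `hBT`).

* `infinite_corner_of_infinite_digit` — the card's `CornerTheorem` shape: the digit set maps into the corner set, so the card's Chebotarev
  statement `DigitSetInfinite` (hypothesis `hInf`; mod-27 Galois representation of `27.2.e.a` + Chebotarev, NOT in the tree) yields
  infinitely many corner instances `(W_p, p)` of the crux — modulo `hDescU`, `hCube`, `hBT`.
* `heegnerTwistCouplingInSupply_sylvester_of_digit` — the crux BODY verbatim for `W := W_n`, `n` a digit-non-zero prime `≡ 8 (mod 9)`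
  (shape of `SylvesterCorner.heegnerTwistCouplingInSupply_sylvester`, the bound `n < 10⁵` replaced by the digit).
* the instance `p = 53`: the slice is the single trace `t = 3`, `H(203) = h(−203) = 4` (kernel), digit `1`; `cruxOnSylvesterCorner_53`.

HONEST FRAMING: corner layer on one CM family; three unformalised inputs (`hDescU` descent, `hCube` class field theory, `hBT` print);
digit-zero primes (≈ 1/3) untouched; nothing here proves the crux or BSD. [cite: CohenPazuki2009, §2] [cite: BurungaleTian2026, Thm. 1.1]
[cite: Cohen1993, §5.3.2 Lemma 5.3.7, p. 234] [cite: SilvermanAEC2009, VII.5 Prop. 5.1(a)]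
-/

noncomputable section

open scoped Classical NumberField

namespace Summit.BirchSwinnertonDyer.BirchSwinnertonDyer.Theorems.FrobeniusFan

open _root_.WeierstrassCurve Literature.NumberTheory.EllipticCurves Literature.NumberTheory.EllipticCurves.Rank1Residual
open Literature.NumberTheory.QuadraticFields
open Summit.BirchSwinnertonDyer.BirchSwinnertonDyer.Theorems.SylvesterCorner

/-! ## §1 Infinite family and the crux body -/

section Family

/-- **The card's `CornerTheorem` shape: the digit set maps into the corner set**, so an infinite digit set (`DigitSetInfinite`: Chebotarev
for the mod-27 representation of `27.2.e.a`, NOT in the tree, taken as the hypothesis `hInf`) gives infinitely many primes `p ≡ 8 (mod 9)`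
at which the conclusion of crux 21381 holds for `(W_p, p)` — MODULO `hDescU`, `hCube`, `hBT`. [cite: CohenPazuki2009, §2]
[cite: BurungaleTian2026, Thm. 1.1] [cite: Cohen1993, §5.3.2 Lemma 5.3.7, p. 234] -/
theorem infinite_corner_of_infinite_digit
    (hDescU : ∀ (p : ℕ) (K : Type) [Field K] [NumberField K], p.Prime → p % 9 = 8 →
      IsImaginaryQuadratic K → 4 < (NumberField.discr K).natAbs →
      jacobiSym (NumberField.discr K) 3 = 1 → jacobiSym (NumberField.discr K) p = 1 →
      ¬ 3 ∣ NumberField.classNumber K →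
      (∀ (L : Type) [Field L] [NumberField L], Module.finrank ℚ L = 2 →
        NumberField.discr L = -3 * NumberField.discr K →
        ∃ u : (𝓞 L)ˣ, ∀ x : 𝓞 L, (u : 𝓞 L) - x ^ 3 ∉ Ideal.span {(p : 𝓞 L)}) →
      ((⟨0, 0, (p : ℚ), 0, 0⟩ : WeierstrassCurve ℚ).quadraticTwist (NumberField.discr K : ℚ)).mordellWeilRank = 0 ∧
      ∀ c ∈ ((⟨0, 0, (p : ℚ), 0, 0⟩ : WeierstrassCurve ℚ).quadraticTwist (NumberField.discr K : ℚ)).sha,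
        3 • c = 0 → c = 0)
    (hCube : ∀ (p : ℕ) (K : Type) [Field K] [NumberField K] (t : ℤ) (c : ℕ), p.Prime → p % 3 = 2 →
      IsImaginaryQuadratic K → NumberField.discr K * (c : ℤ) ^ 2 = t ^ 2 - 4 * p → 3 ∣ t → ¬ 9 ∣ t →
      ¬ 3 ∣ NumberField.classNumber K →
      ∀ (L : Type) [Field L] [NumberField L], Module.finrank ℚ L = 2 →
        NumberField.discr L = -3 * NumberField.discr K →
        ∃ u : (𝓞 L)ˣ, ∀ x : 𝓞 L, (u : 𝓞 L) - x ^ 3 ∉ Ideal.span {(p : 𝓞 L)})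
    (hBT : burungaleTian_analyticRank_eq_zero_of_selmerCorank_eq_zero_of_hasCM)
    (hInf : Set.Infinite {p : ℕ | p.Prime ∧ p % 9 = 8 ∧
      ¬ (3 : ℤ) ∣ (∑ t ∈ (Finset.Ioo (-(2 * (p : ℤ))) (2 * p)).filter (fun t ↦ t % 27 = 3 ∧ t ^ 2 < 4 * (p : ℤ)),
        hurwitzClassNumber (4 * p - t ^ 2)).num}) :
    Set.Infinite {p : ℕ | ∃ hp : p.Prime, p % 9 = 8 ∧
      haveI := isElliptic_sylvester hp.ne_zero
      ∃ (K : Type) (_ : Field K) (_ : NumberField K),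
        IsImaginaryQuadratic K ∧ 4 < (NumberField.discr K).natAbs ∧
        SatisfiesHeegnerHypothesis ((⟨0, 0, (p : ℚ), 0, 0⟩ : WeierstrassCurve ℚ).conductorNorm ℤ) K ∧
        ((⟨0, 0, (p : ℚ), 0, 0⟩ : WeierstrassCurve ℚ).quadraticTwist (NumberField.discr K : ℚ)).entireLFunction 1 ≠ 0 ∧
        NumberField.classNumber K < p ∧ ¬ p ∣ NumberField.classNumber K} := by
  refine hInf.mono fun p hp' ↦ ?_
  obtain ⟨hp, hp9, hdigit⟩ := hp'
  exact ⟨hp, hp9, cruxOnSylvesterCorner_of_digit hDescU hCube hBT p hp hp9 hdigit⟩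

/-- ★★ **THE CRUX BODY ON `W := W_n` FOR EVERY DIGIT-NON-ZERO PRIME `n ≡ 8 (mod 9)`** (shape of
`SylvesterCorner.heegnerTwistCouplingInSupply_sylvester`, the bound `n < 10⁵` replaced by the digit): for every prime `p` and all the crux's
hypotheses on `(W_n, p)` (only `¬ Good` and `5 ≤ p` are used: `p = n`), a Heegner `K′` of `N(W_n)` with `4 < |d_{K′}|`, `L(W_n^{(d_{K′})}, 1) ≠ 0`,
`p ∤ h(K′)` — MODULO `hDescU`, `hCube`, `hBT`. [cite: CohenPazuki2009, §2] [cite: BurungaleTian2026, Thm. 1.1] [cite: SilvermanAEC2009, VII.5 Prop. 5.1(a)] -/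
theorem heegnerTwistCouplingInSupply_sylvester_of_digit
    (hDescU : ∀ (p : ℕ) (K : Type) [Field K] [NumberField K], p.Prime → p % 9 = 8 →
      IsImaginaryQuadratic K → 4 < (NumberField.discr K).natAbs →
      jacobiSym (NumberField.discr K) 3 = 1 → jacobiSym (NumberField.discr K) p = 1 →
      ¬ 3 ∣ NumberField.classNumber K →
      (∀ (L : Type) [Field L] [NumberField L], Module.finrank ℚ L = 2 →
        NumberField.discr L = -3 * NumberField.discr K →
        ∃ u : (𝓞 L)ˣ, ∀ x : 𝓞 L, (u : 𝓞 L) - x ^ 3 ∉ Ideal.span {(p : 𝓞 L)}) →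
      ((⟨0, 0, (p : ℚ), 0, 0⟩ : WeierstrassCurve ℚ).quadraticTwist (NumberField.discr K : ℚ)).mordellWeilRank = 0 ∧
      ∀ c ∈ ((⟨0, 0, (p : ℚ), 0, 0⟩ : WeierstrassCurve ℚ).quadraticTwist (NumberField.discr K : ℚ)).sha,
        3 • c = 0 → c = 0)
    (hCube : ∀ (p : ℕ) (K : Type) [Field K] [NumberField K] (t : ℤ) (c : ℕ), p.Prime → p % 3 = 2 →
      IsImaginaryQuadratic K → NumberField.discr K * (c : ℤ) ^ 2 = t ^ 2 - 4 * p → 3 ∣ t → ¬ 9 ∣ t →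
      ¬ 3 ∣ NumberField.classNumber K →
      ∀ (L : Type) [Field L] [NumberField L], Module.finrank ℚ L = 2 →
        NumberField.discr L = -3 * NumberField.discr K →
        ∃ u : (𝓞 L)ˣ, ∀ x : 𝓞 L, (u : 𝓞 L) - x ^ 3 ∉ Ideal.span {(p : 𝓞 L)})
    (hBT : burungaleTian_analyticRank_eq_zero_of_selmerCorank_eq_zero_of_hasCM) {n : ℕ} (hn : n.Prime) (hn9 : n % 9 = 8)
    (hdigit : ¬ (3 : ℤ) ∣ (∑ t ∈ (Finset.Ioo (-(2 * (n : ℤ))) (2 * n)).filter (fun t ↦ t % 27 = 3 ∧ t ^ 2 < 4 * (n : ℤ)),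
      hurwitzClassNumber (4 * n - t ^ 2)).num) :
    ∀ (p : ℕ) [Fact p.Prime] [(⟨0, 0, (n : ℚ), 0, 0⟩ : WeierstrassCurve ℚ).IsElliptic]
      [(⟨0, 0, (n : ℚ), 0, 0⟩ : WeierstrassCurve ℚ).IsGloballyMinimal]
      [NeZero ((⟨0, 0, (n : ℚ), 0, 0⟩ : WeierstrassCurve ℚ).conductorNorm ℤ)],
      (⟨0, 0, (n : ℚ), 0, 0⟩ : WeierstrassCurve ℚ).HasCM → (⟨0, 0, (n : ℚ), 0, 0⟩ : WeierstrassCurve ℚ).analyticRank = 1 → 5 ≤ p →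
      CMInert (⟨0, 0, (n : ℚ), 0, 0⟩ : WeierstrassCurve ℚ) p → ¬ Good (⟨0, 0, (n : ℚ), 0, 0⟩ : WeierstrassCurve ℚ) p →
      (∀ B : ℕ, ∃ (K : Type) (_ : Field K) (_ : NumberField K), IsImaginaryQuadratic K ∧ B < (NumberField.discr K).natAbs ∧
        4 < (NumberField.discr K).natAbs ∧
        SatisfiesHeegnerHypothesis ((⟨0, 0, (n : ℚ), 0, 0⟩ : WeierstrassCurve ℚ).conductorNorm ℤ) K ∧
        ¬ p ∣ NumberField.classNumber K) →
      ∃ (K : Type) (_ : Field K) (_ : NumberField K),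
        IsImaginaryQuadratic K ∧ 4 < (NumberField.discr K).natAbs ∧
        SatisfiesHeegnerHypothesis ((⟨0, 0, (n : ℚ), 0, 0⟩ : WeierstrassCurve ℚ).conductorNorm ℤ) K ∧
        ((⟨0, 0, (n : ℚ), 0, 0⟩ : WeierstrassCurve ℚ).quadraticTwist (NumberField.discr K : ℚ)).entireLFunction 1 ≠ 0 ∧
        ¬ p ∣ NumberField.classNumber K := by
  intro p _ _ _ _ _ _ h5 _ hbad _
  obtain rfl := eq_of_not_good_sylvester hn h5 hbad
  obtain ⟨K, iF, iN, hK, h4, hH, hL, -, hndvd⟩ := cruxConclusion_of_digit hDescU hCube hBT hn hn9 hdigit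
  exact ⟨K, iF, iN, hK, h4, hH, hL, hndvd⟩

end Family

/-! ## §2 The instance `p = 53`: `t = 3`, `H(203) = h(−203) = 4`, digit `1` -/

section Instance

/-- `H(203) = h(−203) = 4` (`−203 = −7·29` is fundamental; kernel value of `BinQF.classNumber`). [cite: Cohen1993, §5.3.2 Lemma 5.3.7, p. 234] -/
theorem hurwitzClassNumber_203 : hurwitzClassNumber 203 = 4 := by
  rw [hurwitzClassNumber_eq_classNumber_of_isFundamental (by norm_num) ?_ (by norm_num) (by norm_num),
    ← BinaryQuadraticForm.binQF_classNumber_eq _ (by norm_num)]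
  · have : Quadratic.BinQF.classNumber (-203) = 4 := by decide +kernel
    rw [this]; norm_num
  · left
    refine ⟨by norm_num, ?_, by norm_num⟩
    exact Int.squarefree_natAbs.mp (by decide +kernel)

/-- **The slice of `p = 53` is the single term `t = 3`: `N₂₇(53, 3) = H(203) = 4`, digit `1 ≠ 0`.** [cite: Cohen1993, §5.3.2 Lemma 5.3.7, p. 234] -/
theorem digit_53 :
    ¬ (3 : ℤ) ∣ (∑ t ∈ (Finset.Ioo (-(2 * ((53 : ℕ) : ℤ))) (2 * (53 : ℕ))).filter
        (fun t ↦ t % 27 = 3 ∧ t ^ 2 < 4 * ((53 : ℕ) : ℤ)), hurwitzClassNumber (4 * (53 : ℕ) - t ^ 2)).num := by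
  have hS : (Finset.Ioo (-(2 * ((53 : ℕ) : ℤ))) (2 * (53 : ℕ))).filter (fun t ↦ t % 27 = 3 ∧ t ^ 2 < 4 * ((53 : ℕ) : ℤ)) = {3} := by
    decide +kernel
  rw [hS, Finset.sum_singleton, show (4 * ((53 : ℕ) : ℤ) - 3 ^ 2 : ℤ) = 203 by norm_num, hurwitzClassNumber_203]
  decide +kernel

/-- ★ **The corner at `p = 53` through the fan** (`K′ = ℚ(√−203)`, `h = 4`), MODULO `hDescU`, `hCube`, `hBT` — an instance of
`cruxOnSylvesterCorner_of_digit` (the table route of `…SylvesterCornerTable` certifies `p = 53` with `D = −11` instead).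
[cite: CohenPazuki2009, §2] [cite: BurungaleTian2026, Thm. 1.1] -/
theorem cruxOnSylvesterCorner_53
    (hDescU : ∀ (p : ℕ) (K : Type) [Field K] [NumberField K], p.Prime → p % 9 = 8 →
      IsImaginaryQuadratic K → 4 < (NumberField.discr K).natAbs →
      jacobiSym (NumberField.discr K) 3 = 1 → jacobiSym (NumberField.discr K) p = 1 →
      ¬ 3 ∣ NumberField.classNumber K →
      (∀ (L : Type) [Field L] [NumberField L], Module.finrank ℚ L = 2 →
        NumberField.discr L = -3 * NumberField.discr K →
        ∃ u : (𝓞 L)ˣ, ∀ x : 𝓞 L, (u : 𝓞 L) - x ^ 3 ∉ Ideal.span {(p : 𝓞 L)}) →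
      ((⟨0, 0, (p : ℚ), 0, 0⟩ : WeierstrassCurve ℚ).quadraticTwist (NumberField.discr K : ℚ)).mordellWeilRank = 0 ∧
      ∀ c ∈ ((⟨0, 0, (p : ℚ), 0, 0⟩ : WeierstrassCurve ℚ).quadraticTwist (NumberField.discr K : ℚ)).sha,
        3 • c = 0 → c = 0)
    (hCube : ∀ (p : ℕ) (K : Type) [Field K] [NumberField K] (t : ℤ) (c : ℕ), p.Prime → p % 3 = 2 →
      IsImaginaryQuadratic K → NumberField.discr K * (c : ℤ) ^ 2 = t ^ 2 - 4 * p → 3 ∣ t → ¬ 9 ∣ t →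
      ¬ 3 ∣ NumberField.classNumber K →
      ∀ (L : Type) [Field L] [NumberField L], Module.finrank ℚ L = 2 →
        NumberField.discr L = -3 * NumberField.discr K →
        ∃ u : (𝓞 L)ˣ, ∀ x : 𝓞 L, (u : 𝓞 L) - x ^ 3 ∉ Ideal.span {(p : 𝓞 L)})
    (hBT : burungaleTian_analyticRank_eq_zero_of_selmerCorank_eq_zero_of_hasCM) :
    haveI := isElliptic_sylvester (p := 53) (by norm_num)
    ∃ (K : Type) (_ : Field K) (_ : NumberField K),
      IsImaginaryQuadratic K ∧ 4 < (NumberField.discr K).natAbs ∧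
      SatisfiesHeegnerHypothesis ((⟨0, 0, ((53 : ℕ) : ℚ), 0, 0⟩ : WeierstrassCurve ℚ).conductorNorm ℤ) K ∧
      ((⟨0, 0, ((53 : ℕ) : ℚ), 0, 0⟩ : WeierstrassCurve ℚ).quadraticTwist (NumberField.discr K : ℚ)).entireLFunction 1 ≠ 0 ∧
      NumberField.classNumber K < 53 ∧ ¬ 53 ∣ NumberField.classNumber K :=
  cruxOnSylvesterCorner_of_digit hDescU hCube hBT 53 (by norm_num) (by norm_num) digit_53

end Instance

end Summit.BirchSwinnertonDyer.BirchSwinnertonDyer.Theorems.FrobeniusFan
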